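import Summits.QuantumFields.YangMills.Theorems.BalabanUVNodesN12TowerProxiesOfClass
import Summits.QuantumFields.YangMills.Theorems.BalabanUVNodesN12GuardedLinAvgRightInverseGauge
import Literature.MathematicalPhysics.QuantumFieldTheory.Balaban1983to89.Node00.WilsonActionSecondVariationGauge
import Literature.MathematicalPhysics.QuantumFieldTheory.Balaban1983to89.B7Prop6Flat

/-!
# DAG node N12 [B15] — THE CHART CURVATURE (P5) OF A (2.12) MINIMISER FROM ITS CLASS, WITHOUT THE GLOBAL SMALL-BELOW LETTER (LOCATED-HSB pen ρ5c-(P5)): gauge covariance of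
# the canonical chart as a FUNCTION, second derivatives along a conjugation, per-bond GAUGES with near-flat cores from the class, and `‖D²Ψ_{U₀}(0)(w,w)‖ ≤ M₂‖w‖²`

[Balaban1985Variational] = «[15]», (2) p. 278, Sect. C (44)–(48) p. 285, (81)–(83) p. 290, (153) p. 301; [Balaban1988Convergent] = «[III]», (2.2) p. 255, (2.10)–(2.13) pp. 256–257;
[Balaban1985Averaging] = «[B-Av]», (8) (11) p. 19, (19) (21)–(23) p. 21; [Balaban1989LargeFieldII] (1.12) p. 359, (1.25) p. 362.

Cell `pub-ymgap`, HUMAN RULINGS D-0062 ∕ D-0149, lane owner `pub-ymgap-dag-n12-c` (g21).  Key K1⁹ `stmt-QuantumFields-27364`, `--kind proof --supports … --as helper`; count-neutral.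
NEW leaf; CONSUMED BY NAME, nothing modified: this lane's `N12TowerProxiesOfClass` (ρ5b: tower geometry, `gaugeAct_inv_gaugeAct_eq`, `chartLetters_msChart_Bj_of_isMinimizer_of_class`) and
`N12ChartRegularityTowerProxies` (ρ5a: `msChart_component_eq_of_towerProxy`), dag-n12-w6's `suProj_conj` ∕ `boxPlaqs_subset_plaqsOf_topSeq_pred` ∕ `exists_word_endpoints`, dag-n12-w4's
`Node00.expChart_gaugeAct` ∕ `fderiv_fderiv_apply_pi` ∕ `exists_uniform_chartCurvature_sq_bound` (its curvature conjunct is the displayed letter `hcurv` here), `B16Sect1Backgrounds.iter_gaugeAct`,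
`B7Prop6Flat.mlog_conj`, the tree's torus axial gauge `T4AxialGaugeSmallField`.

WHY.  After ρ5a–ρ5c the only `hsb`-consumers left on the direct road are (P4)′ (dag-n12-w6, box proxies) and (P5): p656421's `exists_chartCurvature_sq_bound_on_compact` bounds
`‖D²Ψ_{U₀}(0)(w,w)‖` on a compact set of SMALL-BELOW fields — at minimisers of data rough off `Z` that guard fails (LOCATED-HSB v2).  HERE the curvature of the chart at a (2.12)
minimiser is read off its CLASS: per constrained bond `(j,c)`, a gauge `u` whose transform of `U₀` flattened off the tower box is a globally `ρ″`-near-flat `V` (pure gauge on `Γ₀`, axial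
gauge at positive levels — ρ5b's construction, exported with its gauge); the `i`-th component of `Ψ_{W,U₀}` is the `i`-th component of the proxy chart (ρ5a §1), which is the conjugate
by `Ad((u↾_j)(c₊))` of the `i`-th component of the chart at `V` precomposed with the isometry `𝒜_u` (§1); second derivatives follow the conjugation (§2); so
`‖(D²Ψ_{U₀}(w,w))_i‖ = ‖(D²Ψ_V(𝒜w,𝒜w))_i‖ ≤ M₂‖w‖²` by w4's uniform curvature bound at the near-flat `V` — for EVERY component, hence for the sup norm.

CONTENTS (namespace `Summit.QuantumFields.YangMills.BalabanUVNodes.N12ChartCurvatureOfClass`; theorems only — no `def`, no `instance`, no `sorry`).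
* §1 `relAvg_gaugeAct`, ★★ `msChart_gaugeAct_apply` (function-level per-component covariance).
* §2 ★ `fderiv_fderiv_conj_apply` (calculus: `D²g(0)(Aw,Aw) = L(D²f(0)(w,w))` when `g ∘ A = L ∘ f`).
* §3 `gaugeAct_gaugeAct_inv`, ★★ `exists_boxGauge_of_plaqSmallOn`, ★★ `exists_towerGauge_of_mem_class_pos`, ★ `exists_towerGauge_zero`, ★★★ `towerGauges_Bj_of_mem_class` (per constrained
  bond: a gauge and a `ρ″`-near-flat core reproducing `U₀` on the tower).
* §4 ★★★ `norm_fderiv_fderiv_msChart_le_of_class` — THE (P5) LETTER `hM₂` FOR A (2.12) MINIMISER WITH NO `SmallBelow` HYPOTHESIS, displayed rows: `k+1 ≤ m+K`, `4L ≤ M₁`, the cube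
  divisibility, `0 ≤ εreg`, the per-height letters `hsbU` ∕ `hcurv` (both conjuncts of `Node00.exists_uniform_chartCurvature_sq_bound k`, before `ν`) and the floor `6(d−1)L·εreg ≤ ρ″`.

HONEST FRAMING ∕ LOCATED.  Kernel calculus + lattice bookkeeping over landed modules; `M₂`, `ρ″` are ∃-constants per height `(F, K, k)`; the (P5) consumers ((D1)′∕(E1)‴, the knit)
are NOT re-keyed here (dag-n12-d's v8); nothing of Bałaban's asserted; count-neutral helper; N12 NOT discharged; K1⁹ NOT closed; counts unmoved; one finite 𝕋⁴ programme at fixed ε —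
R4 closes the conditional finite-𝕋⁴ rung `BalabanLadder.UV` only; NOT continuum ∕ OS ∕ mass gap ∕ Clay.
-/

noncomputable section

open scoped BigOperators Matrix.Norms.L2Operator Topology
open Filter Finset

namespace Summit.QuantumFields.YangMills.BalabanUVNodes.N12ChartCurvatureOfClass

open Literature.MathematicalPhysics.QuantumFieldTheory.Balaban1983to89
open T4Continuum (T4Family walkEnd)
open T4AdjointCovarianceUnitary (lieSU specialUnitaryAd coe_specialUnitaryAd norm_specialUnitaryAd)
open B15DeterminingSets
open B14.Eq213MaximalDomains (side)
open B14.Eq213DetSet (Bj Bj_of_gt Bj_mid Bj_top maxDomT)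
open B14.Eq216Concrete (feeds inputs iter_local feeds_zero)
open B15Eq112TorusCover (lift cover cover_lift)
open T4AxialGaugeSmallField (castSite boxPlaqs boxBonds axialGauge dist1_gaugeAct_axialGauge_le_of_mem_boxBonds)
open B16Sect1Backgrounds (toMS iter_gaugeAct)
open T4ReflectionCone (three_le_L)
open Node00
open MatrixLog (mlog)
open Summit.QuantumFields.YangMills.BalabanUVNodes.N12GuardedLinAvgRightInverseGauge (suProj_conj)
open Summit.QuantumFields.YangMills.BalabanUVNodes.N12ChartRegularityTowerProxies (msChart_component_eq_of_towerProxy)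
open Summit.QuantumFields.YangMills.BalabanUVNodes.N12WindowNearRegionGeometry (boxPlaqs_subset_plaqsOf_topSeq_pred exists_word_endpoints)
open Summit.QuantumFields.YangMills.BalabanUVNodes.N12TowerProxiesOfClass (towerBox_lt_sitesPerDir boxSide_mul_eta_sq_le gaugeAct_inv_gaugeAct_eq shift_ne_self feeds_subset_boxBonds
  chartLetters_msChart_Bj_of_isMinimizer_of_class)

variable {F : T4Family} {N : ℕ} [NeZero N] {K k : ℕ}

/-! ## §1  Gauge covariance of the chart, as a function -/

/-- **GAUGE COVARIANCE OF THE RELATIVE AVERAGE**: at the transformed pair (`U^u`, `W^u := (u↾_j)(c₋)·W_j(c)·(u↾_j)(c₊)⁻¹`) and the transformed coordinate `(𝒜_u X)_b = Ad(u(b₊))X_b`,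
`W^u_j(c)*·Ū^j(U^u·e^{𝒜X})(c) = (u↾_j)(c₊)·(W_j(c)*·Ū^j(U·e^X)(c))·(u↾_j)(c₊)*` (covariance of the chart `expChart_gaugeAct` and of the averages `iter_gaugeAct`).
[cite: Balaban1985Averaging, (8) p.19, (11) p.19; Balaban1989LargeFieldII, (1.25) p.362, p.357; Balaban1985Variational, (47) p.285] -/
theorem relAvg_gaugeAct (hk : k ≤ (F.P K).m + (F.P K).K) (u : GaugeTransf (F.P K) 0 (SU N)) (W : MSField (F.P K) (SU N))
    (U : GaugeField (F.P K) 0 (SU N)) (X : PBond (F.P K) 0 → lieSU (Fin N)) {j : ℕ} (hj : j ≤ k) (c : PBond (F.P K) j) :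
    relAvg K (fun j c => toMS u j c.src * W j c * (toMS u j c.tgt)⁻¹) (expChart (GaugeField.gaugeAct u U) (fun b => specialUnitaryAd (u b.tgt) (X b))) j c
      = ((toMS u j c.tgt : SU N) : Matrix (Fin N) (Fin N) ℂ) * relAvg K W (expChart U X) j c * star ((toMS u j c.tgt : SU N) : Matrix (Fin N) (Fin N) ℂ) := by
  rw [relAvg, relAvg, expChart_gaugeAct]
  have hav : avgFamily (avOfRecord F N K) (GaugeField.gaugeAct u (expChart U X)) j c
      = toMS u j c.src * avgFamily (avOfRecord F N K) (expChart U X) j c * (toMS u j c.tgt)⁻¹ := by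
    show Averaging.iter (avOfRecord F N K) j (GaugeField.gaugeAct u (expChart U X)) c = _
    rw [iter_gaugeAct (avOfRecord F N K) u (expChart U X) j (hj.trans hk)]
    rfl
  rw [hav]
  set a : SU N := toMS u j c.src
  set b : SU N := toMS u j c.tgt
  set w : SU N := W j c
  set m : SU N := avgFamily (avOfRecord F N K) (expChart U X) j c
  -- `(a w b⁻¹)* (a m b⁻¹) = b (w* m) b*`
  have ha : star ((a : SU N) : Matrix (Fin N) (Fin N) ℂ) * ((a : SU N) : Matrix (Fin N) (Fin N) ℂ) = 1 := star_coe_mul_coe_SU a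
  have hb : ((b⁻¹ : SU N) : Matrix (Fin N) (Fin N) ℂ) = star ((b : SU N) : Matrix (Fin N) (Fin N) ℂ) := rfl
  rw [Submonoid.coe_mul, Submonoid.coe_mul, Submonoid.coe_mul, Submonoid.coe_mul, hb, StarMul.star_mul, StarMul.star_mul, star_star]
  calc ((b : SU N) : Matrix (Fin N) (Fin N) ℂ) * (star ((w : SU N) : Matrix (Fin N) (Fin N) ℂ) * star ((a : SU N) : Matrix (Fin N) (Fin N) ℂ)) *
        (((a : SU N) : Matrix (Fin N) (Fin N) ℂ) * ((m : SU N) : Matrix (Fin N) (Fin N) ℂ) * star ((b : SU N) : Matrix (Fin N) (Fin N) ℂ))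
      = ((b : SU N) : Matrix (Fin N) (Fin N) ℂ) * star ((w : SU N) : Matrix (Fin N) (Fin N) ℂ) * (star ((a : SU N) : Matrix (Fin N) (Fin N) ℂ) * ((a : SU N) : Matrix (Fin N) (Fin N) ℂ))
          * ((m : SU N) : Matrix (Fin N) (Fin N) ℂ) * star ((b : SU N) : Matrix (Fin N) (Fin N) ℂ) := by noncomm_ring
    _ = ((b : SU N) : Matrix (Fin N) (Fin N) ℂ) * (star ((w : SU N) : Matrix (Fin N) (Fin N) ℂ) * ((m : SU N) : Matrix (Fin N) (Fin N) ℂ)) * star ((b : SU N) : Matrix (Fin N) (Fin N) ℂ) := by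
          rw [ha]; noncomm_ring

/-- ★★ **THE CHART IS GAUGE COVARIANT, COMPONENT BY COMPONENT, AS A FUNCTION**: `Ψ_{𝐁,W^u,U^u}(𝒜_u X) i = Ad((u↾_j)(c_{i,+})) (Ψ_{𝐁,W,U}(X) i)` for EVERY `X` — the function-level
statement behind dag-n12-w6's first-derivative covariance `fderiv_msChart_gaugeAct_apply` (logarithm and `𝔰𝔲`-projection commute with conjugation: `B7Prop6Flat.mlog_conj`, `suProj_conj`).
[cite: Balaban1985Variational, (47)–(48) p.285, (153) p.301; Balaban1985Averaging, (11) p.19, (21)–(23) p.21; Balaban1989LargeFieldII, (1.25) p.362] -/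
theorem msChart_gaugeAct_apply (hk : k ≤ (F.P K).m + (F.P K).K) {𝔹 : DetSet (F.P K)} (u : GaugeTransf (F.P K) 0 (SU N)) (W : MSField (F.P K) (SU N))
    (U : GaugeField (F.P K) 0 (SU N)) (X : PBond (F.P K) 0 → lieSU (Fin N)) (i : Fin (constrCard 𝔹 k)) :
    msChart F N K k 𝔹 (fun j c => toMS u j c.src * W j c * (toMS u j c.tgt)⁻¹) (GaugeField.gaugeAct u U) (fun b => specialUnitaryAd (u b.tgt) (X b)) i
      = specialUnitaryAd (toMS u (((constrEnum 𝔹 k).symm i).1 : ℕ) ((constrEnum 𝔹 k).symm i).2.1.tgt) (msChart F N K k 𝔹 W U X i) := by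
  have hj : (((constrEnum 𝔹 k).symm i).1 : ℕ) ≤ k := Nat.le_of_lt_succ ((constrEnum 𝔹 k).symm i).1.2
  rw [msChart_apply, msChart_apply, relAvg_gaugeAct hk u W U X hj]
  set b : SU N := toMS u (((constrEnum 𝔹 k).symm i).1 : ℕ) ((constrEnum 𝔹 k).symm i).2.1.tgt
  set R : Matrix (Fin N) (Fin N) ℂ := relAvg K W (expChart U X) (((constrEnum 𝔹 k).symm i).1 : ℕ) ((constrEnum 𝔹 k).symm i).2.1
  -- `log (b R b*) = b (log R) b*` (conjugation commutes with the logarithmic series) and `π (b M b*) = Ad b (π M)`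
  let ub : (Matrix (Fin N) (Fin N) ℂ)ˣ := ⟨(b : Matrix (Fin N) (Fin N) ℂ), star (b : Matrix (Fin N) (Fin N) ℂ), coe_mul_star_coe_SU b, star_coe_mul_coe_SU b⟩
  have hlog : mlog (((b : SU N) : Matrix (Fin N) (Fin N) ℂ) * R * star ((b : SU N) : Matrix (Fin N) (Fin N) ℂ))
      = ((b : SU N) : Matrix (Fin N) (Fin N) ℂ) * mlog R * star ((b : SU N) : Matrix (Fin N) (Fin N) ℂ) :=
    B7Prop6Flat.mlog_conj ub R
  rw [hlog, suProj_conj]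


/-- ★ **SECOND DERIVATIVES ALONG A CONJUGATION**: if `g (A X) = L (f X)` for linear homeomorphisms `A` (source) and `L` (target), then `D²g(0)(A w, A w) = L (D²f(0)(w, w))` —
no differentiability hypothesis (iterated derivatives of a composition with continuous linear equivalences). [folklore] -/
theorem fderiv_fderiv_conj_apply {E₁ F₁ : Type*} [NormedAddCommGroup E₁] [NormedSpace ℝ E₁] [NormedAddCommGroup F₁] [NormedSpace ℝ F₁]
    (A : E₁ ≃L[ℝ] E₁) (L : F₁ ≃L[ℝ] F₁) {f g : E₁ → F₁} (hfg : ∀ X, g (A X) = L (f X)) (w : E₁) :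
    fderiv ℝ (fderiv ℝ g) 0 (A w) (A w) = L (fderiv ℝ (fderiv ℝ f) 0 w w) := by
  have hg : g = (L : F₁ → F₁) ∘ (f ∘ (A.symm : E₁ → E₁)) := by
    funext Y
    have h := hfg (A.symm Y)
    rw [ContinuousLinearEquiv.apply_symm_apply] at h
    exact h
  have h1 : iteratedFDeriv ℝ 2 g 0 = (L : F₁ →L[ℝ] F₁).compContinuousMultilinearMap (iteratedFDeriv ℝ 2 (f ∘ (A.symm : E₁ → E₁)) 0) := by
    rw [hg]; exact L.iteratedFDeriv_comp_left
  have h2 : iteratedFDeriv ℝ 2 (f ∘ (A.symm : E₁ → E₁)) 0 = (iteratedFDeriv ℝ 2 f (A.symm 0)).compContinuousLinearMap fun _ => (A.symm : E₁ →L[ℝ] E₁) := by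
    have h := A.symm.iteratedFDerivWithin_comp_right f uniqueDiffOn_univ (Set.mem_univ (A.symm 0)) 2
    rw [Set.preimage_univ, iteratedFDerivWithin_univ, iteratedFDerivWithin_univ] at h
    exact h
  have h3 : fderiv ℝ (fderiv ℝ g) 0 (A w) (A w) = iteratedFDeriv ℝ 2 g 0 ![A w, A w] := by
    rw [iteratedFDeriv_two_apply]; rfl
  have h4 : fderiv ℝ (fderiv ℝ f) 0 w w = iteratedFDeriv ℝ 2 f 0 ![w, w] := by
    rw [iteratedFDeriv_two_apply]; rfl
  rw [h3, h4, h1, ContinuousLinearMap.compContinuousMultilinearMap_coe, Function.comp_apply, h2,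
    ContinuousMultilinearMap.compContinuousLinearMap_apply, map_zero, ContinuousLinearEquiv.coe_coe]
  have hm : (fun j : Fin 2 => (A.symm : E₁ →L[ℝ] E₁) (![A w, A w] j)) = ![w, w] := by
    funext j
    fin_cases j <;> simp
  rw [hm]


/-! ## §3  Per-bond gauges with near-flat cores, from the class -/

/-- `u • (u⁻¹ • V) = V` for the pointwise inverse gauge transformation. [cite: Balaban1985Averaging, (8) p.19 (bookkeeping)] -/
theorem gaugeAct_gaugeAct_inv {P : Params} {G : Type*} [GaugeGroup G] (u : GaugeTransf P 0 G) (V : GaugeField P 0 G) :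
    GaugeField.gaugeAct u (GaugeField.gaugeAct (fun s => (u s)⁻¹ : GaugeTransf P 0 G) V) = V := by
  funext b; simp only [GaugeField.gaugeAct]; group

/-- ★★ **THE BOX GAUGE WITH A NEAR-FLAT CORE**: for a non-wrapping coordinate box on which `U₀` is `δ`-plaquette-small, the torus axial gauge `u` of the box and the flattening `V` of `u•U₀`
off the box satisfy `‖V − 1‖ ≤ (d−1)·n·δ` and `u⁻¹•V = U₀` on every bond of the box (ρ5b's `exists_boxProxy_of_plaqSmallOn` with its gauge exported).
[cite: Balaban1985Averaging, (19) p.21, (8) p.19; Balaban1988Convergent, (2.11) p.256] -/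
theorem exists_boxGauge_of_plaqSmallOn (Kt : ℕ) {lo hi : Fin (F.P Kt).d → ℤ} {n : ℕ}
    (hnb : ∀ κ, hi κ ≤ lo κ + n) (hnN : n < (F.P Kt).sitesPerDir 0) {S₀ : Set (Plaq (F.P Kt) 0)} (hS₀ : (boxPlaqs lo hi : Set (Plaq (F.P Kt) 0)) ⊆ S₀)
    {δ : ℝ} (hδ0 : 0 ≤ δ) {U₀ : GaugeField (F.P Kt) 0 (SU N)} (hU : PlaqSmallOn S₀ δ U₀) :
    ∃ (u : GaugeTransf (F.P Kt) 0 (SU N)) (V : GaugeField (F.P Kt) 0 (SU N)), ‖coeField V - 1‖ ≤ ((((F.P Kt).d - 1 : ℕ)) : ℝ) * n * δ ∧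
      ∀ b ∈ (boxBonds lo hi : Set (PBond (F.P Kt) 0)), GaugeField.gaugeAct (fun s => (u s)⁻¹ : GaugeTransf (F.P Kt) 0 (SU N)) V b = U₀ b := by
  set u : GaugeTransf (F.P Kt) 0 (SU N) := axialGauge U₀ lo hi with hu
  have hbond : ∀ b ∈ (boxBonds lo hi : Set (PBond (F.P Kt) 0)),
      ‖((GaugeField.gaugeAct u U₀ b : SU N) : Matrix (Fin N) (Fin N) ℂ) - 1‖ ≤ ((((F.P Kt).d - 1 : ℕ)) : ℝ) * n * δ := by
    intro b hb
    have h := dist1_gaugeAct_axialGauge_le_of_mem_boxBonds U₀ hS₀ hU hδ0 hnb hnN hb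
    have e1 : dist1 (GaugeField.gaugeAct u U₀ b) = ‖((GaugeField.gaugeAct u U₀ b : SU N) : Matrix (Fin N) (Fin N) ℂ) - 1‖ := rfl
    rw [← e1]; exact h
  obtain ⟨V, hVeq, hVflat⟩ := exists_nearFlat_eqOn (GaugeField.gaugeAct u U₀) (boxBonds lo hi : Set (PBond (F.P Kt) 0)) (by positivity) hbond
  exact ⟨u, V, hVflat, fun b hb => gaugeAct_inv_gaugeAct_eq u U₀ V (hVeq b hb)⟩

/-- ★★ **THE TOWER GAUGE OF A POSITIVE-LEVEL CONSTRAINED BOND, FROM THE CLASS**: for `U₀ ∈ U_k({Ω_j(Z)}, εreg)`, `1 ≤ j ≤ k`, `c` meeting `Γ_j(Z)` (`k+1 ≤ m+K`, `4L ≤ M₁`, cube divisibility,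
`0 ≤ εreg`): a gauge `u` and a core `V` with `‖V − 1‖ ≤ 6(d−1)L·εreg` and `u⁻¹•V = U₀` on `feeds j c` (ρ5b's tower construction, gauge exported).
[cite: Balaban1985Variational, (2) p.278; Balaban1988Convergent, (2.2) p.255, (2.11)–(2.13) pp.256–257; Balaban1985Averaging, (19) p.21] -/
theorem exists_towerGauge_of_mem_class_pos (ν : Stage7Numerics) (Kt : ℕ) {k : ℕ} (Z : Set (Site (F.P Kt) 0))
    (hkK : k + 1 ≤ (F.P Kt).m + (F.P Kt).K) (hM4 : 4 * (F.P Kt).L ≤ ν.M₁) (hdiv : side (F.P Kt).L ν.M₁ k ∣ (F.P Kt).sitesPerDir 0)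
    (hε : 0 ≤ ν.εreg) {U₀ : GaugeField (F.P Kt) 0 (SU N)} (hU₀ : U₀ ∈ regMSCoPOfRecord F N ν Kt k (maxDomT ν.M₁ Z))
    {j : ℕ} (hj1 : 1 ≤ j) (hjk : j ≤ k) {c : PBond (F.P Kt) j} (hc : c ∈ bondsOf (Bj ν.M₁ Z k j)) :
    ∃ (u : GaugeTransf (F.P Kt) 0 (SU N)) (V : GaugeField (F.P Kt) 0 (SU N)),
      ‖coeField V - 1‖ ≤ 6 * ((((F.P Kt).d - 1 : ℕ)) : ℝ) * (F.P Kt).L * ν.εreg ∧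
      ∀ b ∈ feeds j c, GaugeField.gaugeAct (fun s => (u s)⁻¹ : GaugeTransf (F.P Kt) 0 (SU N)) V b = U₀ b := by
  have hk : k ≤ (F.P Kt).m + (F.P Kt).K := by omega
  have hjK : j ≤ (F.P Kt).m + (F.P Kt).K := hjk.trans hk
  have hM1 : 1 ≤ ν.M₁ := le_trans (by have := three_le_L (F.P Kt); omega) hM4
  obtain ⟨y, hy, hyΩ⟩ : ∃ y : Site (F.P Kt) j, (y = c.src ∨ y = c.tgt) ∧ embIter j y ∈ maxDomT ν.M₁ Z j := by
    have hsub : Bj ν.M₁ Z k j ⊆ pts j (maxDomT ν.M₁ Z j) := by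
      rcases lt_or_eq_of_le hjk with hlt | rfl
      · rw [Bj_mid hj1 hlt]; exact fun _ h => h.1
      · rw [Bj_top]
    rcases hc with h | h
    · exact ⟨c.src, Or.inl rfl, mem_pts.1 (hsub h)⟩
    · exact ⟨c.tgt, Or.inr rfl, mem_pts.1 (hsub h)⟩
  obtain ⟨w₀, hw₀len, hw₀⟩ := exists_word_endpoints c hy (Or.inl rfl : c.src = c.src ∨ c.src = c.tgt)
  set R : ℕ := 3 * (F.P Kt).L ^ j - 3 with hR
  set lo : Fin (F.P Kt).d → ℤ := fun κ => (((embIter j c.src) κ).val : ℤ) - (R : ℤ) with hlo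
  set hi : Fin (F.P Kt).d → ℤ := fun κ => (((embIter j c.src) κ).val : ℤ) + (R : ℤ) + 2 with hhi
  have hq : 1 ≤ (F.P Kt).L ^ j := Nat.one_le_pow _ _ (F.P Kt).L_pos
  have hfitR : (F.P Kt).L ^ j + R + 3 ≤ (F.P Kt).L ^ (j - 1) * ν.M₁ := by
    obtain ⟨i, rfl⟩ : ∃ i, j = i + 1 := ⟨j - 1, by omega⟩
    rw [Nat.add_sub_cancel, hR]
    have h4A : 4 * (F.P Kt).L ^ (i + 1) ≤ (F.P Kt).L ^ i * ν.M₁ :=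
      calc 4 * (F.P Kt).L ^ (i + 1) = (F.P Kt).L ^ i * (4 * (F.P Kt).L) := by ring
        _ ≤ (F.P Kt).L ^ i * ν.M₁ := Nat.mul_le_mul_left _ hM4
    omega
  have hplaqs : (boxPlaqs lo hi : Set (Plaq (F.P Kt) 0)) ⊆
      B8Eq17ClassAkV1.plaqsOf (topSeq (suppDomOfRecord F ν Kt (maxDomT ν.M₁ Z)) (maxDomT ν.M₁ Z) (j - 1)) :=
    boxPlaqs_subset_plaqsOf_topSeq_pred ν Kt hj1 hjk hM1 hdiv Z hyΩ hw₀ hw₀len hfitR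
  have hnb : ∀ κ, hi κ ≤ lo κ + ((6 * (F.P Kt).L ^ j - 4 : ℕ) : ℕ) := fun κ => by
    simp only [hlo, hhi, hR]
    omega
  have hnN : 6 * (F.P Kt).L ^ j - 4 < (F.P Kt).sitesPerDir 0 := towerBox_lt_sitesPerDir (F.P Kt) hkK hjk
  have hδ0 : 0 ≤ ν.εreg * (F.P Kt).eta (j - 1) ^ 2 := by positivity
  obtain ⟨u, V, hV, hUV⟩ := exists_boxGauge_of_plaqSmallOn (N := N) Kt hnb hnN hplaqs hδ0 (hU₀.1 (j - 1) (by omega))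
  refine ⟨u, V, hV.trans ?_, fun b hb => hUV b (feeds_subset_boxBonds hjK c hb)⟩
  have hside := boxSide_mul_eta_sq_le (F.P Kt) hj1
  calc ((((F.P Kt).d - 1 : ℕ)) : ℝ) * ((6 * (F.P Kt).L ^ j - 4 : ℕ) : ℕ) * (ν.εreg * (F.P Kt).eta (j - 1) ^ 2)
      = ((((F.P Kt).d - 1 : ℕ)) : ℝ) * ((((6 * (F.P Kt).L ^ j - 4 : ℕ) : ℝ) * (F.P Kt).eta (j - 1) ^ 2) * ν.εreg) := by ring
    _ ≤ ((((F.P Kt).d - 1 : ℕ)) : ℝ) * ((6 * ((F.P Kt).L : ℝ)) * ν.εreg) := by gcongr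
    _ = 6 * ((((F.P Kt).d - 1 : ℕ)) : ℝ) * (F.P Kt).L * ν.εreg := by ring

/-- ★ **THE TOWER GAUGE OF A LEVEL-0 CONSTRAINED BOND** (`feeds 0 c = {c}`): `u(c₊) := U₀(c)`, `u := 1` elsewhere, core `V := 1`: `(u⁻¹•1)(c) = U₀(c)`.
[cite: Balaban1988Convergent, (2.2) p.255, (2.11) p.256; Balaban1985Averaging, (8) p.19] -/
theorem exists_towerGauge_zero {P : Params} {ρ : ℝ} (hρ : 0 ≤ ρ) (U₀ : GaugeField P 0 (SU N)) (c : PBond P 0) :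
    ∃ (u : GaugeTransf P 0 (SU N)) (V : GaugeField P 0 (SU N)), ‖coeField V - 1‖ ≤ ρ ∧
      ∀ b ∈ feeds 0 c, GaugeField.gaugeAct (fun s => (u s)⁻¹ : GaugeTransf P 0 (SU N)) V b = U₀ b := by
  classical
  refine ⟨fun s => if s = c.tgt then U₀ c else 1, 1, ?_, fun b hb => ?_⟩
  · have : coeField (1 : GaugeField P 0 (SU N)) - 1 = 0 := by funext b; simp [coeField]
    rw [this, norm_zero]; exact hρ
  · rw [feeds_zero, Set.mem_singleton_iff] at hb
    subst hb
    have hne : b.src ≠ b.tgt := fun h => shift_ne_self b.src b.dir (h.symm)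
    have h3 : (1 : GaugeField P 0 (SU N)) b = 1 := rfl
    simp [GaugeField.gaugeAct, hne, h3]

/-- ★★★ **PER CONSTRAINED BOND OF `𝐁_k(Z)`: A GAUGE AND A NEAR-FLAT CORE REPRODUCING `U₀` ON THE TOWER**, from class membership (`k+1 ≤ m+K`, `4L ≤ M₁`, cube divisibility, `0 ≤ εreg`).
[cite: Balaban1985Variational, (2) p.278; Balaban1988Convergent, (2.2) p.255, (2.11)–(2.13) pp.256–257] -/
theorem towerGauges_Bj_of_mem_class (ν : Stage7Numerics) (Kt : ℕ) {k : ℕ} (Z : Set (Site (F.P Kt) 0))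
    (hkK : k + 1 ≤ (F.P Kt).m + (F.P Kt).K) (hM4 : 4 * (F.P Kt).L ≤ ν.M₁) (hdiv : side (F.P Kt).L ν.M₁ k ∣ (F.P Kt).sitesPerDir 0)
    (hε : 0 ≤ ν.εreg) {U₀ : GaugeField (F.P Kt) 0 (SU N)} (hU₀ : U₀ ∈ regMSCoPOfRecord F N ν Kt k (maxDomT ν.M₁ Z))
    (i : Fin (constrCard (Bj ν.M₁ Z k) k)) :
    ∃ (u : GaugeTransf (F.P Kt) 0 (SU N)) (V : GaugeField (F.P Kt) 0 (SU N)),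
      ‖coeField V - 1‖ ≤ 6 * ((((F.P Kt).d - 1 : ℕ)) : ℝ) * (F.P Kt).L * ν.εreg ∧
      ∀ b ∈ feeds (((constrEnum (Bj ν.M₁ Z k) k).symm i).1 : ℕ) ((constrEnum (Bj ν.M₁ Z k) k).symm i).2.1,
        GaugeField.gaugeAct (fun s => (u s)⁻¹ : GaugeTransf (F.P Kt) 0 (SU N)) V b = U₀ b := by
  have key : ∀ j, j ≤ k → ∀ c : PBond (F.P Kt) j, c ∈ bondsOf (Bj ν.M₁ Z k j) →
      ∃ (u : GaugeTransf (F.P Kt) 0 (SU N)) (V : GaugeField (F.P Kt) 0 (SU N)),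
        ‖coeField V - 1‖ ≤ 6 * ((((F.P Kt).d - 1 : ℕ)) : ℝ) * (F.P Kt).L * ν.εreg ∧
        ∀ b ∈ feeds j c, GaugeField.gaugeAct (fun s => (u s)⁻¹ : GaugeTransf (F.P Kt) 0 (SU N)) V b = U₀ b := by
    intro j hj c hc
    rcases Nat.eq_zero_or_pos j with rfl | hj1
    · exact exists_towerGauge_zero (by have := three_le_L (F.P Kt); positivity) U₀ c
    · exact exists_towerGauge_of_mem_class_pos ν Kt Z hkK hM4 hdiv hε hU₀ hj1 hj hc
  exact key _ (Nat.le_of_lt_succ ((constrEnum (Bj ν.M₁ Z k) k).symm i).1.2) _ ((constrEnum (Bj ν.M₁ Z k) k).symm i).2.2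

/-! ## §4  The curvature letter (P5) at a (2.12) minimiser, from the class -/

set_option maxHeartbeats 400000 in
/-- ★★★ **THE (P5) LETTER `hM₂` FOR A (2.12) MINIMISER WITH NO `SmallBelow` HYPOTHESIS**: `‖D²Ψ_{𝐁_k(Z),W,U₀}(0)(w,w)‖ ≤ M₂‖w‖²` for every `w`, where `M₂, ρ″` are the height's constants of
`Node00.exists_uniform_chartCurvature_sq_bound k` (displayed as the letters `hsbU`, `hcurv`), given class membership of the minimiser, `k+1 ≤ m+K`, `4L ≤ M₁`, the cube divisibility,
`0 ≤ εreg` and the volume-free floor `6(d−1)L·εreg ≤ ρ″`.  Per component: proxy chart (ρ5a §1) → gauge covariance (§1) → conjugated second derivative (§2) → w4's bound at the near-flat core.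
[cite: Balaban1985Variational, Sect. C (44)–(48) p.285, (81)–(83) p.290, (153) p.301; Balaban1989LargeFieldII, (1.12) p.359, (1.25) p.362; Balaban1988Convergent, (2.10)–(2.13) pp.256–257] -/
theorem norm_fderiv_fderiv_msChart_le_of_class (ν : Stage7Numerics) (Kt : ℕ) {k : ℕ} (Z : Set (Site (F.P Kt) 0))
    (hkK : k + 1 ≤ (F.P Kt).m + (F.P Kt).K) (hM4 : 4 * (F.P Kt).L ≤ ν.M₁) (hdiv : side (F.P Kt).L ν.M₁ k ∣ (F.P Kt).sitesPerDir 0)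
    (hε : 0 ≤ ν.εreg) {ρ'' M₂ : ℝ} (hM₂0 : 0 ≤ M₂)
    (hsbU : ∀ V : GaugeField (F.P Kt) 0 (SU N), ‖coeField V - 1‖ ≤ ρ'' → SmallBelow (avOfRecord F N Kt) k V)
    (hcurv : ∀ (𝔹 : DetSet (F.P Kt)) (W : MSField (F.P Kt) (SU N)) (V : GaugeField (F.P Kt) 0 (SU N)),
      ‖coeField V - 1‖ ≤ ρ'' → AgreeOn 𝔹 (avgFamily (avOfRecord F N Kt) V) W →
      ∀ w : PBond (F.P Kt) 0 → lieSU (Fin N), ‖fderiv ℝ (fderiv ℝ (msChart F N Kt k 𝔹 W V)) 0 w w‖ ≤ M₂ * ‖w‖ ^ 2)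
    (hερ : 6 * ((((F.P Kt).d - 1 : ℕ)) : ℝ) * (F.P Kt).L * ν.εreg ≤ ρ'')
    {W : MSField (F.P Kt) (SU N)} {U₀ : GaugeField (F.P Kt) 0 (SU N)}
    (h : IsMinimizer (avOfRecord F N Kt) (regMSCoPOfRecord F N ν Kt k (maxDomT ν.M₁ Z)) (Bj ν.M₁ Z k) W U₀)
    (w : PBond (F.P Kt) 0 → lieSU (Fin N)) :
    ‖fderiv ℝ (fderiv ℝ (msChart F N Kt k (Bj ν.M₁ Z k) W U₀)) 0 w w‖ ≤ M₂ * ‖w‖ ^ 2 := by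
  have hk : k ≤ (F.P Kt).m + (F.P Kt).K := by omega
  have h𝔹 : ∀ j, k < j → (Bj ν.M₁ Z k : DetSet (F.P Kt)) j = ∅ := fun _ hj => Bj_of_gt hj
  -- regularity of the chart at `U₀` (from the class, ρ5b)
  obtain ⟨-, -, ⟨hΨ₂, hΨd⟩, -⟩ := chartLetters_msChart_Bj_of_isMinimizer_of_class ν Kt Z hkK hM4 hdiv hε hsbU hερ h
  refine (pi_norm_le_iff_of_nonneg (by positivity)).2 fun i => ?_
  -- the gauge and the near-flat core of the `i`-th tower
  obtain ⟨u, V, hV, hin⟩ := towerGauges_Bj_of_mem_class ν Kt Z hkK hM4 hdiv hε h.1 i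
  set U' : GaugeField (F.P Kt) 0 (SU N) := GaugeField.gaugeAct (fun s => (u s)⁻¹ : GaugeTransf (F.P Kt) 0 (SU N)) V with hU'
  have hVρ : ‖coeField V - 1‖ ≤ ρ'' := hV.trans hερ
  have hsbV : SmallBelow (avOfRecord F N Kt) k V := hsbU V hVρ
  have huU' : GaugeField.gaugeAct u U' = V := gaugeAct_gaugeAct_inv u V
  -- the proxy chart and its `i`-th component
  set W' : MSField (F.P Kt) (SU N) := avgFamily (avOfRecord F N Kt) U' with hW'
  have hcomp := msChart_component_eq_of_towerProxy (𝔹 := Bj ν.M₁ Z k) (W := W) (U := U₀) hk h.2.1 i hin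
  -- the transformed pair (`V = u•U'`, `W'^u`) and the coordinate isometry `𝒜`
  set Wu : MSField (F.P Kt) (SU N) := fun j c => toMS u j c.src * W' j c * (toMS u j c.tgt)⁻¹ with hWu
  let 𝒜 : (PBond (F.P Kt) 0 → lieSU (Fin N)) ≃L[ℝ] (PBond (F.P Kt) 0 → lieSU (Fin N)) :=
    ContinuousLinearEquiv.piCongrRight fun b => (specialUnitaryAd (u b.tgt)).toContinuousLinearEquiv
  have h𝒜 : ∀ X b, 𝒜 X b = specialUnitaryAd (u b.tgt) (X b) := fun X b => rfl
  set bi : SU N := toMS u (((constrEnum (Bj ν.M₁ Z k) k).symm i).1 : ℕ) ((constrEnum (Bj ν.M₁ Z k) k).symm i).2.1.tgt with hbi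
  let L : lieSU (Fin N) ≃L[ℝ] lieSU (Fin N) := (specialUnitaryAd bi).toContinuousLinearEquiv
  have hcov : ∀ X, msChart F N Kt k (Bj ν.M₁ Z k) Wu V (𝒜 X) i = L (msChart F N Kt k (Bj ν.M₁ Z k) W' U' X i) := by
    intro X
    have hX : (𝒜 X : PBond (F.P Kt) 0 → lieSU (Fin N)) = fun b => specialUnitaryAd (u b.tgt) (X b) := funext (h𝒜 X)
    show msChart F N Kt k (Bj ν.M₁ Z k) Wu V (𝒜 X) i = specialUnitaryAd bi (msChart F N Kt k (Bj ν.M₁ Z k) W' U' X i)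
    rw [hX, ← huU']
    exact msChart_gaugeAct_apply hk u W' U' X i
  have hconj := fderiv_fderiv_conj_apply 𝒜 L (f := fun Y => msChart F N Kt k (Bj ν.M₁ Z k) W' U' Y i)
    (g := fun Y => msChart F N Kt k (Bj ν.M₁ Z k) Wu V Y i) hcov w
  -- the chart at `V` is regular (near-flat core) and in the fibre of `W'^u`
  have hfibV : AgreeOn (Bj ν.M₁ Z k) (avgFamily (avOfRecord F N Kt) V) Wu := by
    intro j c hc
    by_cases hj : j ≤ k
    · show Averaging.iter (avOfRecord F N Kt) j V c = _
      rw [← huU', iter_gaugeAct (avOfRecord F N Kt) u U' j (hj.trans hk)]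
      rfl
    · exfalso; rw [h𝔹 j (lt_of_not_ge hj)] at hc; simp [bondsOf] at hc
  obtain ⟨hΨ₂V, hΨdV⟩ := regularity_binders_msChart (k := k) (𝔹 := Bj ν.M₁ Z k) hfibV hsbV
  have h𝒜w : ‖𝒜 w‖ ≤ ‖w‖ :=
    (pi_norm_le_iff_of_nonneg (norm_nonneg w)).2 fun b => by rw [h𝒜, norm_specialUnitaryAd]; exact norm_le_pi_norm w b
  -- assemble: component at `U₀` = component of the proxy chart = conjugate of the `V`-chart's component at `𝒜 w` (all comparisons up to definitional unfolding)
  have e1 := fderiv_fderiv_apply_pi hΨd hΨ₂.differentiableAt i w w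
  have e2 : fderiv ℝ (fderiv ℝ (fun X => msChart F N Kt k (Bj ν.M₁ Z k) W U₀ X i)) 0 w w
      = fderiv ℝ (fderiv ℝ (fun X => msChart F N Kt k (Bj ν.M₁ Z k) W' U' X i)) 0 w w := by rw [hcomp]
  have e3 := fderiv_fderiv_apply_pi hΨdV hΨ₂V.differentiableAt i (𝒜 w) (𝒜 w)
  have key0 : ‖fderiv ℝ (fderiv ℝ (msChart F N Kt k (Bj ν.M₁ Z k) Wu V)) 0 (𝒜 w) (𝒜 w)‖ ≤ M₂ * ‖𝒜 w‖ ^ 2 :=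
    hcurv (Bj ν.M₁ Z k) Wu V hVρ hfibV (𝒜 w)
  have key1 : M₂ * ‖𝒜 w‖ ^ 2 ≤ M₂ * ‖w‖ ^ 2 := by gcongr
  have key : ‖fderiv ℝ (fderiv ℝ (msChart F N Kt k (Bj ν.M₁ Z k) Wu V)) 0 (𝒜 w) (𝒜 w) i‖ ≤ M₂ * ‖w‖ ^ 2 :=
    ((norm_le_pi_norm (fderiv ℝ (fderiv ℝ (msChart F N Kt k (Bj ν.M₁ Z k) Wu V)) 0 (𝒜 w) (𝒜 w)) i).trans key0).trans key1
  have c1 : ‖fderiv ℝ (fderiv ℝ (msChart F N Kt k (Bj ν.M₁ Z k) W U₀)) 0 w w i‖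
      = ‖fderiv ℝ (fderiv ℝ (fun X => msChart F N Kt k (Bj ν.M₁ Z k) W' U' X i)) 0 w w‖ := congrArg norm (e1.trans e2)
  have c2 : ‖fderiv ℝ (fderiv ℝ (fun X => msChart F N Kt k (Bj ν.M₁ Z k) W' U' X i)) 0 w w‖
      = ‖L (fderiv ℝ (fderiv ℝ (fun X => msChart F N Kt k (Bj ν.M₁ Z k) W' U' X i)) 0 w w)‖ := (norm_specialUnitaryAd bi _).symm
  have c3 : ‖L (fderiv ℝ (fderiv ℝ (fun X => msChart F N Kt k (Bj ν.M₁ Z k) W' U' X i)) 0 w w)‖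
      = ‖fderiv ℝ (fderiv ℝ (fun Y => msChart F N Kt k (Bj ν.M₁ Z k) Wu V Y i)) 0 (𝒜 w) (𝒜 w)‖ := congrArg norm hconj.symm
  have c4 : ‖fderiv ℝ (fderiv ℝ (fun Y => msChart F N Kt k (Bj ν.M₁ Z k) Wu V Y i)) 0 (𝒜 w) (𝒜 w)‖
      = ‖fderiv ℝ (fderiv ℝ (msChart F N Kt k (Bj ν.M₁ Z k) Wu V)) 0 (𝒜 w) (𝒜 w) i‖ := congrArg norm e3.symm
  exact (c1.trans (c2.trans (c3.trans c4))).trans_le key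

end Summit.QuantumFields.YangMills.BalabanUVNodes.N12ChartCurvatureOfClass

end
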